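import Literature.AnabelianGeometry.EtaleTheta.SettingModelGfpLevelKernelRigidity
import Literature.AnabelianGeometry.EtaleTheta.SettingModelTateDoubleUnderline
import HarnessLib

/-!
# The level-kernel TEST for the extension hypothesis `hextΔ` at the Tate model `Π^tp_X = Γ ⋊_{actχq} G_{ℚ_p}`
# (K-L6 «HEXT-DECIDE@modelχq», sub-row R5-1 «HEXT-LEVELKER-TEST», proof-only)

S. Mochizuki, *The étale theta function and its Frobenioid-theoretic manifestations* [EtTh], Publ. RIMS **45**
(2009): §1 p. 12–14 (the coverings `Z_N → Y_N → X`, `Δ^tp_{Z_N} = Ker pr₂ ∩ Ker ĥ_N`), Prop. 2.4 (i) p. 38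
(«any automorphism of `Π^tp_{X̲̲}` induces automorphisms of `Π^tp_X`» — the shape of the hypothesis `hextΔ`
carried BY NAME by abc-iut-L6-t2's `rigidData_cor218_i_modelχq_of_extends_of_hgal` (p490266) and abc-iut-w5-d169's
`piYddCharacteristic_modelχq_of_extends` (p492265)), Def. 2.5 (i) p. 39 (`X̲̲ → X`).
[cite: MochizukiEtTh2009, Prop 2.4(i) p.38]

abc-iut cell, layer L6 / K-L6 row «HEXT-DECIDE@modelχq», sub-row R5-1 «HEXT-LEVELKER-TEST» (K2) (abc-iut-L6-lead
§F v1.19du (B2), v1.19dw (A), v1.19dz (B) GO), seat abc-iut-L6-t13 (gen 12); reader-of-record abc-iut-w5-d169 (g11,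
NO OBJECTION 04:32:04Z, remarks (r1)/(r2) adopted below).  File B of 2 (file A = `SettingModelGfpLevelKernelRigidity`:
every continuous endomorphism of `F̂₂` preserves `Ker ĥ_N`, `N` odd; concurring independent kernel check of the same
ingredient by abc-iut-w5-d162 g9, staged `SettingModelLevelKerEndoStable.lean` 21ec5798382bfcab).  PROOF-ONLY: no
definition, no instance, no `Prop`-valued fact; nothing of another seat is edited or restated — abc-iut-L2-t5's
`PiTpχq p i j` / `curveχq` (`SettingModelTateSemidirect`), abc-iut-L2-d1's `Huuχq` (`SettingModelTateDoubleUnderline`),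
abc-iut-L2-t8's `EtaleThetaData.DoubleUnderline` are consumed BY NAME.

WHAT THIS FILE PROVES (numbers, not adjectives; EVERY prime `p`, EVERY `i j : ℤ`, EVERY odd `N`).
* §1 `apply_inl_mem_inl_ker_levelHom_iff` / ★ `map_inl_ker_levelHom_eq_of_map_deltaTemp_eq` — **every
  `Δ^tp_X`-stabilising topological automorphism `Γ` of `Π^tp_X = Γ ⋊_{actχq} G_{ℚ_p}` maps `inl (Ker levelHom N)` ONTO
  itself** (`Γ|_{Δ}` is a continuous endomorphism of `Γ`, file A applies to it and to `Γ⁻¹|_{Δ}`).  This is the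
  POSITIVE CERTIFICATE that the candidates of R5-2 «HEXT-REFUTER-HUNT@class2» (abc-iut-w5-d233) and of clause (iv) of
  «XTHETA-KER@modelTate» (abc-iut-w5-d145) must beat.
* §2 ★ `not_hext_of_moves_levelKer` — **the TEST**: for ANY subgroup `H ≤ Π^tp_X`, if some bicontinuous automorphism
  `γ` of `H` moves an element of `H ∩ inl (Ker levelHom N)` out of `inl (Ker levelHom N)`, then the extension
  hypothesis «every bicontinuous `γ : H ≃ₜ* H` extends to a `Δ^tp_X`-stabilising topological automorphism of `Π^tp_X`»
  FAILS; `apply_mem_inl_ker_levelHom_iff_of_extends` is the pointwise form for ONE `γ` that extends.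
* §3 `not_hext_Huu_of_moves_levelKer` — the literal corollary at `H = C.Huu` for every étale-theta datum `E` over
  `ThetaSetting.modelχq p i j hj` and every `X̲̲`-choice `C : E.DoubleUnderline l`, in the binder shape of p490266
  l.416–418 / p492265; `inl_mem_Huuχq_of_mem_ker_levelHom` records that `inl (Ker levelHom l) ≤ Huuχq p i j l hl`
  (the `X̲̲` of record), so at `N = l` the tested subgroup lies inside `Π^tp_{X̲̲}`.

HONEST SCOPE (reader-of-record's (r2), verbatim in substance): the level-kernel test is the VERBAL SHADOW of the true
necessary condition «`γ|_{inl dUU l}` is the restriction of a bicontinuous automorphism of `Γ` (indeed of one whose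
completion is a continuous endomorphism of `F̂₂`)»: every candidate that MOVES `N_l := Ker levelHom l` fails `hextΔ`
by §2, but a candidate PRESERVING every `Ker ĥ_N` (`N` odd) is NOT thereby a `hextΔ`-witness (the cocycle /
`G_{ℚ_p}`-compatibility and the `Γ`-extension remain) — this file decides REFUTATIONS ONLY, never `hextΔ` itself, which
stays UNDECIDED-AT-MODEL (abc-iut-w5-d169's verdict 04:04:31Z, §F v1.19du (B)).  `modelχq` is a SEMI-SYNTHETIC model
of the typed [EtTh] §1 interface (binder-satisfiability evidence for OUR typing only, not the tempered `π₁` of a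
curve); nothing of [EtTh] is asserted beyond the tree's proofs; no side is taken on [IUTchIII] Cor. 3.12; typed ≠
proved; nothing here says abc is proved or refuted.
-/

noncomputable section

namespace Literature.AnabelianGeometry.EtaleTheta.SettingModel

open Literature.AnabelianGeometry.SemiGraphs Function Topology

variable (p : ℕ) [Fact p.Prime] (i j : ℤ)

/-! ## §1. `Δ^tp_X`-stabilising automorphisms of `Π^tp_X` preserve `inl (Ker levelHom N)`, `N` odd -/

/-- `g ↦ g.left` is continuous on `Π^tp_X` (induced topology). [folklore] -/
private theorem continuous_leftχq' : Continuous fun g : PiTpχq p i j => g.left :=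
  continuous_fst.comp (continuous_leftRightχq p i j)

/-- If `Γ` stabilises `Δ^tp_X` then `(Γ (inl q)).right = 1`. [folklore] -/
private theorem right_apply_inl_eq_one' (Γ : PiTpχq p i j ≃ₜ* PiTpχq p i j)
    (hΔ : (curveχq p i j).DeltaTemp.map Γ.toMulEquiv.toMonoidHom = (curveχq p i j).DeltaTemp) (q : Gfp) :
    (Γ (SemidirectProduct.inl q)).right = 1 := by
  have hmem : Γ (SemidirectProduct.inl q) ∈ (curveχq p i j).DeltaTemp := by
    rw [← hΔ]; exact ⟨SemidirectProduct.inl q, inl_mem_deltaTempχq p i j q, rfl⟩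
  exact (mem_deltaTempχq_iff p i j _).mp hmem

/-- If `Γ` stabilises `Δ^tp_X`, so does `Γ⁻¹`. [folklore] -/
private theorem map_deltaTemp_symm_eq' (Γ : PiTpχq p i j ≃ₜ* PiTpχq p i j)
    (hΔ : (curveχq p i j).DeltaTemp.map Γ.toMulEquiv.toMonoidHom = (curveχq p i j).DeltaTemp) :
    (curveχq p i j).DeltaTemp.map Γ.symm.toMulEquiv.toMonoidHom = (curveχq p i j).DeltaTemp := by
  refine le_antisymm ?_ ?_
  · rintro _ ⟨x, hx, rfl⟩
    have hx2 : x ∈ (curveχq p i j).DeltaTemp.map Γ.toMulEquiv.toMonoidHom := by rw [hΔ]; exact hx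
    obtain ⟨y, hy, rfl⟩ := hx2
    change Γ.symm (Γ y) ∈ _
    rw [Γ.symm_apply_apply]; exact hy
  · intro x hx
    refine ⟨Γ x, ?_, Γ.symm_apply_apply x⟩
    rw [← hΔ]; exact ⟨x, hx, rfl⟩

/-- **A `Δ^tp_X`-stabilising topological automorphism of `Π^tp_X` restricts along `inl` to a CONTINUOUS ENDOMORPHISM
of `Γ`** (`Γ (inl q) = inl (φ q)`; general `i j` — the `j = 2` equivalence form is abc-iut-L6-t2's
`exists_restrict_of_map_deltaTemp_eq`, not restated: an endomorphism is all file A needs).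
[cite: MochizukiEtTh2009, §1 p.12] -/
theorem exists_continuousMonoidHom_restrict_of_map_deltaTemp_eq (Γ : PiTpχq p i j ≃ₜ* PiTpχq p i j)
    (hΔ : (curveχq p i j).DeltaTemp.map Γ.toMulEquiv.toMonoidHom = (curveχq p i j).DeltaTemp) :
    ∃ φ : Gfp →ₜ* Gfp, ∀ q : Gfp, Γ (SemidirectProduct.inl q) = SemidirectProduct.inl (φ q) := by
  have hr : ∀ q : Gfp, (Γ (SemidirectProduct.inl q)).right = 1 := right_apply_inl_eq_one' p i j Γ hΔ
  have hinl : ∀ q : Gfp,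
      Γ (SemidirectProduct.inl q) = SemidirectProduct.inl (Γ (SemidirectProduct.inl q)).left :=
    fun q => by ext <;> simp [hr q]
  have hmul : ∀ a b : Gfp, (Γ (SemidirectProduct.inl (a * b))).left =
      (Γ (SemidirectProduct.inl a)).left * (Γ (SemidirectProduct.inl b)).left := fun a b => by
    have h := congrArg SemidirectProduct.left
      (show Γ (SemidirectProduct.inl (a * b)) = Γ (SemidirectProduct.inl a) * Γ (SemidirectProduct.inl b) by
        rw [← map_mul, ← map_mul])
    rw [h, hinl a, hinl b, ← map_mul, SemidirectProduct.left_inl, SemidirectProduct.left_inl,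
      SemidirectProduct.left_inl]
  exact ⟨⟨MonoidHom.mk' (fun q => (Γ (SemidirectProduct.inl q)).left) hmul,
      (continuous_leftχq' p i j).comp (Γ.continuous.comp (continuous_inlχq p i j))⟩, fun q => hinl q⟩

/-- **Pointwise form**: for a `Δ^tp_X`-stabilising topological automorphism `Γ` of `Π^tp_X` and odd `N`,
`Γ (inl q) ∈ inl (Ker levelHom N) ↔ q ∈ Ker levelHom N`. [cite: MochizukiEtTh2009, §1 p.14] -/
theorem apply_inl_mem_inl_ker_levelHom_iff (Γ : PiTpχq p i j ≃ₜ* PiTpχq p i j)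
    (hΔ : (curveχq p i j).DeltaTemp.map Γ.toMulEquiv.toMonoidHom = (curveχq p i j).DeltaTemp)
    (N : ℕ+) (hN : Odd (N : ℕ)) (q : Gfp) :
    Γ (SemidirectProduct.inl q) ∈
        ((levelHom N).ker).map (SemidirectProduct.inl : Gfp →* PiTpχq p i j) ↔ q ∈ (levelHom N).ker := by
  obtain ⟨φ, hφ⟩ := exists_continuousMonoidHom_restrict_of_map_deltaTemp_eq p i j Γ hΔ
  obtain ⟨ψ, hψ⟩ := exists_continuousMonoidHom_restrict_of_map_deltaTemp_eq p i j Γ.symm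
    (map_deltaTemp_symm_eq' p i j Γ hΔ)
  constructor
  · rintro ⟨r, hr, hrq⟩
    have h1 : (SemidirectProduct.inl (ψ r) : PiTpχq p i j) = SemidirectProduct.inl q := by
      rw [← hψ r, hrq, Γ.symm_apply_apply]
    rw [← SemidirectProduct.inl_injective h1]
    exact apply_mem_ker_levelHom_of ψ N hN hr
  · intro hq
    exact ⟨φ q, apply_mem_ker_levelHom_of φ N hN hq, (hφ q).symm⟩

/-- **Every `Δ^tp_X`-stabilising topological automorphism of `Π^tp_X = Γ ⋊_{actχq} G_{ℚ_p}` maps `inl (Ker levelHom N)`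
ONTO itself** (`N` odd; every `p`, `i`, `j`) — the positive certificate R5-2 / XTHETA-KER (iv) candidates must beat.
[cite: MochizukiEtTh2009, §1 p.14] -/
theorem map_inl_ker_levelHom_eq_of_map_deltaTemp_eq (Γ : PiTpχq p i j ≃ₜ* PiTpχq p i j)
    (hΔ : (curveχq p i j).DeltaTemp.map Γ.toMulEquiv.toMonoidHom = (curveχq p i j).DeltaTemp)
    (N : ℕ+) (hN : Odd (N : ℕ)) :
    (((levelHom N).ker).map (SemidirectProduct.inl : Gfp →* PiTpχq p i j)).map Γ.toMulEquiv.toMonoidHom =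
      ((levelHom N).ker).map (SemidirectProduct.inl : Gfp →* PiTpχq p i j) := by
  ext g
  constructor
  · rintro ⟨_, ⟨q, hq, rfl⟩, rfl⟩
    exact (apply_inl_mem_inl_ker_levelHom_iff p i j Γ hΔ N hN q).mpr hq
  · rintro ⟨q, hq, rfl⟩
    obtain ⟨ψ, hψ⟩ := exists_continuousMonoidHom_restrict_of_map_deltaTemp_eq p i j Γ.symm
      (map_deltaTemp_symm_eq' p i j Γ hΔ)
    refine ⟨SemidirectProduct.inl (ψ q), ⟨ψ q, apply_mem_ker_levelHom_of ψ N hN hq, rfl⟩, ?_⟩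
    change Γ (SemidirectProduct.inl (ψ q)) = SemidirectProduct.inl q
    rw [← hψ q, Γ.apply_symm_apply]

/-! ## §2. The test: an automorphism of `H ≤ Π^tp_X` moving `inl (Ker levelHom N)` admits no `Δ`-stabilising extension -/

variable {p i j}

/-- **Pointwise form for ONE automorphism that extends**: if `γ : H ≃ₜ* H` is the restriction of a
`Δ^tp_X`-stabilising topological automorphism of `Π^tp_X`, then `γ` preserves membership in `inl (Ker levelHom N)`
(`N` odd). [cite: MochizukiEtTh2009, Prop 2.4(i) p.38] -/
theorem apply_mem_inl_ker_levelHom_iff_of_extends {H : Subgroup (PiTpχq p i j)} (γ : H ≃ₜ* H)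
    (hext : ∃ Γ : PiTpχq p i j ≃ₜ* PiTpχq p i j,
      (∀ h : H, Γ (h : PiTpχq p i j) = ((γ h : H) : PiTpχq p i j)) ∧
        (curveχq p i j).DeltaTemp.map Γ.toMulEquiv.toMonoidHom = (curveχq p i j).DeltaTemp)
    (N : ℕ+) (hN : Odd (N : ℕ)) (h : H) :
    ((γ h : H) : PiTpχq p i j) ∈ ((levelHom N).ker).map (SemidirectProduct.inl : Gfp →* PiTpχq p i j) ↔
      (h : PiTpχq p i j) ∈ ((levelHom N).ker).map (SemidirectProduct.inl : Gfp →* PiTpχq p i j) := by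
  obtain ⟨Γ, hΓ, hΔ⟩ := hext
  rw [← hΓ h]
  constructor
  · intro hh
    have hh' : Γ (h : PiTpχq p i j) ∈
        (((levelHom N).ker).map (SemidirectProduct.inl : Gfp →* PiTpχq p i j)).map Γ.toMulEquiv.toMonoidHom := by
      rw [map_inl_ker_levelHom_eq_of_map_deltaTemp_eq p i j Γ hΔ N hN]; exact hh
    obtain ⟨x, hx, hxe⟩ := hh'
    have : x = (h : PiTpχq p i j) := Γ.injective hxe
    rw [← this]; exact hx
  · intro hh
    have : Γ (h : PiTpχq p i j) ∈
        (((levelHom N).ker).map (SemidirectProduct.inl : Gfp →* PiTpχq p i j)).map Γ.toMulEquiv.toMonoidHom :=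
      ⟨h, hh, rfl⟩
    rwa [map_inl_ker_levelHom_eq_of_map_deltaTemp_eq p i j Γ hΔ N hN] at this

/-- **The level-kernel TEST (`not_hext_of_moves_levelKer`)**: for ANY subgroup `H ≤ Π^tp_X = Γ ⋊_{actχq} G_{ℚ_p}` and
any odd `N`, ONE bicontinuous automorphism `γ` of `H` moving an element of `H ∩ inl (Ker levelHom N)` out of
`inl (Ker levelHom N)` refutes «every bicontinuous automorphism of `H` extends to a `Δ^tp_X`-stabilising topological
automorphism of `Π^tp_X`» (the hypothesis `hextΔ` of the K-L6 `_of_extends` files at `H = Π^tp_{X̲̲}`).  For a mover in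
the other direction (`h ∉`, `γ h ∈`) apply this to `γ.symm` and `γ h`. [cite: MochizukiEtTh2009, Prop 2.4(i) p.38] -/
theorem not_hext_of_moves_levelKer {H : Subgroup (PiTpχq p i j)} (N : ℕ+) (hN : Odd (N : ℕ))
    (hmove : ∃ γ : H ≃ₜ* H, ∃ h : H,
      (h : PiTpχq p i j) ∈ ((levelHom N).ker).map (SemidirectProduct.inl : Gfp →* PiTpχq p i j) ∧
        ((γ h : H) : PiTpχq p i j) ∉ ((levelHom N).ker).map (SemidirectProduct.inl : Gfp →* PiTpχq p i j)) :
    ¬ ∀ γ : H ≃ₜ* H, ∃ Γ : PiTpχq p i j ≃ₜ* PiTpχq p i j,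
        (∀ h : H, Γ (h : PiTpχq p i j) = ((γ h : H) : PiTpχq p i j)) ∧
          (curveχq p i j).DeltaTemp.map Γ.toMulEquiv.toMonoidHom = (curveχq p i j).DeltaTemp := by
  intro hext
  obtain ⟨γ, h, hh, hγh⟩ := hmove
  exact hγh ((apply_mem_inl_ker_levelHom_iff_of_extends γ (hext γ) N hN h).mpr hh)

/-! ## §3. The corollary at `Π^tp_{X̲̲} = C.Huu` over `ThetaSetting.modelχq`, and the `X̲̲` of record -/

/-- `inl (Ker levelHom l) ≤ Π^tp_{X̲̲}` for abc-iut-L2-d1's `X̲̲` of record `Huuχq p i j l hl = dUU l ⋊ G_{ℚ_p}`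
(`Ker levelHom l ≤ dUU l = {x = z = 0}`): at `N = l` the tested subgroup lies inside `Π^tp_{X̲̲}`.
[cite: MochizukiEtTh2009, Def 2.5(i) p.39] -/
theorem inl_mem_Huuχq_of_mem_ker_levelHom (l : ℕ+) (hl : Odd (l : ℕ)) {q : Gfp} (hq : q ∈ (levelHom l).ker) :
    (SemidirectProduct.inl q : PiTpχq p i j) ∈ Huuχq p i j l hl := by
  rw [inl_mem_Huuχq_iff, mem_dUU_iff]
  rw [MonoidHom.mem_ker] at hq
  rw [hq]
  exact ⟨rfl, rfl⟩

/-- **The TEST at `H = Π^tp_{X̲̲} = C.Huu`**, for EVERY étale-theta datum `E` over the Tate model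
`ThetaSetting.modelχq p i j hj` and EVERY `X̲̲`-choice `C : E.DoubleUnderline l`, in the literal binder shape of the
`hext` hypothesis of abc-iut-L6-t2's `rigidData_cor218_i_modelχq_of_extends_of_hgal` (p490266) / abc-iut-w5-d169's
`piYddCharacteristic_modelχq_of_extends` (p492265): one bicontinuous automorphism of `C.Huu` moving an element of
`C.Huu ∩ inl (Ker levelHom N)` (`N` odd; `N = l` is the case of record) out of `inl (Ker levelHom N)` REFUTES `hextΔ`
at the model.  Decides refutations only (see the file header). [cite: MochizukiEtTh2009, Prop 2.4(i) p.38] -/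
theorem not_hext_Huu_of_moves_levelKer {hj : Even j}
    {E : (ThetaSetting.modelχq p i j hj).EtaleThetaData} {l : ℕ} (C : E.DoubleUnderline l)
    (N : ℕ+) (hN : Odd (N : ℕ))
    (hmove : ∃ γ : ↥C.Huu ≃ₜ* ↥C.Huu, ∃ h : C.Huu,
      (h : PiTpχq p i j) ∈ ((levelHom N).ker).map (SemidirectProduct.inl : Gfp →* PiTpχq p i j) ∧
        ((γ h : C.Huu) : PiTpχq p i j) ∉ ((levelHom N).ker).map (SemidirectProduct.inl : Gfp →* PiTpχq p i j)) :
    ¬ ∀ γ : ↥C.Huu ≃ₜ* ↥C.Huu, ∃ Γ : PiTpχq p i j ≃ₜ* PiTpχq p i j,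
        (∀ h : C.Huu, Γ (h : PiTpχq p i j) = ((γ h : C.Huu) : PiTpχq p i j)) ∧
          (curveχq p i j).DeltaTemp.map Γ.toMulEquiv.toMonoidHom = (curveχq p i j).DeltaTemp :=
  not_hext_of_moves_levelKer (H := C.Huu) N hN hmove

end Literature.AnabelianGeometry.EtaleTheta.SettingModel
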